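import Literature.MathematicalPhysics.QuantumLattice.TIGroundEnergyDensityConservedDensities
import Literature.MathematicalPhysics.QuantumLattice.HubbardOneBodyKinematicRows
import Literature.MathematicalPhysics.QuantumLattice.HubbardTTPrimeCapCutDualRows
import Literature.MathematicalPhysics.QuantumLattice.HubbardNNNHoppingTorusLimitCorrelator
import Literature.MathematicalPhysics.QuantumLattice.HubbardTTPrimeDiagHopTransportMinimiser
import HarnessLib

/-!
# An energy-window word certified at ONE `(t, t', U)` anchor holds for every ground state at every
# coupling of a box: class-wide kinematic brackets of the three conjugate densities, the excess budget,
# and the torus-limit ground-state form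

Topic `Literature/MathematicalPhysics/QuantumLattice` (family `hubbard`). The `t–t'–U` instance of
`TIGroundEnergyDensityCouplingFamilies.lean` §11 (`of_energyWindow_word_of_isMinOn`: an energy-window
word issued at one anchor of a linear coupling family holds for every class minimiser at every coupling
whose excess `Σ_a |θ_a − θ₀_a|(hi_a − lo_a)` fits the window). Written for stage S2 of the Hubbard
material-oracle programme («points → parameter BOXES»; D-0097): the observable / pairing words of the
programme are ENERGY-WINDOW WORDS — «every translation-invariant state of filling `ρ` whose `t–t'–U` mean
energy is within `ε` of the ground-state energy density satisfies `P`» (energy-constrained relaxations,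
Wang et al. 2024 §III; the tree's window certificates `…re_expect_ge_of_window_certificate_TT'_ineq…`) —
and a delivered material box is a box in `(t'/t, U/t)` at fixed filling.

* §1 CLASS-WIDE KINEMATIC BRACKETS for EVERY translation-invariant state of filling `0 < ρ < 2`
  (no torus-limit or ground-state hypothesis — the class over which the variational density is taken):
  `|K₁(σ)| ≤ 16/π²` (`IsTranslationInvariant.abs_meanEnergy_nnHop_le`: the variational inequality at
  `(±1, 0, 0)` against the half-filled free band; the `K₂` twin is the tree's
  `IsTranslationInvariant.abs_meanEnergy_diagHop_le`, `HubbardTTPrimeDiagHopTransportMinimiser` — whose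
  `t'`-only box rule `forall_minimiser_tPrime_box_of_forall_cap` this file extends to the joint
  `(t, t', U)` box), and `0 ≤ D(σ) ≤ ρ/2` for the
  double-occupancy density (`meanEnergy_hubbardTTPrime_onSite_eq_re_expect_docc` — the identity
  `e_{Φ(0,0,1)}(σ) = Re σ(n_{0↑}n_{0↓})` for EVERY state, by the on-site lemma of
  `TIGroundEnergyDensityConservedDensities` — and the projection bounds).
* §2 THE BOX RULE (`hubbardTTPrime_energyWindow_word_of_isMinOn`): if
  `∀ σ` TI of filling `ρ`, `e_{Φ(t₀,t'₀,U₀)}(σ) ≤ e(t₀,t'₀,U₀,ρ) + ε → P σ` (`U₀ ≥ 0`), then every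
  translation-invariant `ω` of filling `ρ` minimising `e_{Φ(t,t',U)}` over that class satisfies `P`
  as soon as `(|t − t₀| + |t' − t'₀|)·(32/π²) + |U − U₀|·(ρ/2) ≤ ε`; general-bracket form
  `…_of_brackets` (certified class-wide brackets `[lo_a, hi_a]` in place of the kinematic ones).
* §3 TORUS-LIMIT GROUND STATES ARE CLASS MINIMISERS (`IsTorusLimitOf.meanEnergy_le_of_filling`:
  `e^{tt'}(ω) = e(t,t',U,ρ)`, `HubbardNNNHoppingTorusLimitCorrelator`, + the variational principle), so
  the box rule reads on the programme's state class: `IsTorusLimitOf.of_energyWindow_word_on_box` — an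
  energy-window word at the anchor holds for EVERY torus-limit ground state at EVERY `(t, t', U)`,
  `U ≥ 0`, of the budgeted box.

Everything is PROVED; no definition, no named fact, no number, no `sorry`. HONEST SCOPE: the kinematic
budget is coarse (`32/π² ≈ 3.24` per unit `|Δt'|`: a `±0.05` `t'`-box costs `ε ≥ 0.162t` plus
`|ΔU|·ρ/2`); certified class-wide brackets (SDP words valid for all TI states of the filling) shrink
it through `…_of_brackets`; nothing here produces a word `P`.

## Mathlib / tree search

Tree (REUSED): `IsTranslationInvariant.energyDensityTT'_le_meanEnergy`,
`energyDensityTT'_le_meanEnergy_of_isTranslationInvariant`, `neg_sixteen_mul_abs_div_pi_sq_le_energyDensityTT'`,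
`…_diag`, `re_expect_docc_nonneg`, `re_expect_nAt_mul_nAt_le[_down]`, `meanEnergy_hubbardTTPrime_eq_coords`,
`hubbardTTPrimeFermionInteraction_apply_pair_unitVec/_diagVec/_singleton/_eq_zero`,
`IsTorusLimitOf.meanEnergy_hubbardTTPrime_eq_energyDensityTT'`, `IsTorusLimitOf.density_eq_of_rectN`,
`InfVolFermionState.meanEnergy_of_onSite`, `of_energyWindow_word_of_isMinOn`,
`hubbardTTPrimeFermionInteraction_eq_linearFamily`, `tiGroundEnergyDensityAt_hubbardTTPrime_eq_energyDensityTT'`.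
`lean search 'IsTranslationInvariant.abs_meanEnergy'`: the `K₂` row exists (`HubbardTTPrimeDiagHopTransportMinimiser`, reused); no `K₁` / docc class-wide rows.

## References

* J. Wang et al., PRX 14 (2024) 031006, §III (energy-constrained relaxations: every state of energy
  below the threshold obeys the certified bound). [cite: WangEtAl2024, §III]
* E. H. Lieb, M. Loss, Duke Math. J. 71 (1993) 337, §8 Thm. 8.2 (bathtub). [cite: LiebLoss1993, §8, Theorem 8.2]
* D. Ruelle, *Statistical Mechanics* (1969), §3.4. [cite: Ruelle1969, §3.4]
* R. B. Griffiths, Phys. Rev. 152 (1966) 240, §II. [cite: Griffiths1966, §II]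
-/

noncomputable section

namespace Literature.MathematicalPhysics.QuantumLattice

open Matrix Finset HubbardWave0 Literature.Probability.LatticeModels ThermodynamicLimit
open _root_.Filter
open scoped _root_.Topology ComplexOrder BigOperators

/-! ### §1. Class-wide kinematic brackets of the three conjugate densities -/

/-- The unit on-site `t–t'–U` interaction has no term off the singletons (its hopping amplitudes are
zero). [cite: XuEtAl2024, eq. (1)] -/
theorem hubbardTTPrimeFermionInteraction_onSite_apply_eq_zero {X : Finset (Site 2)}
    (h1 : ∀ x : Site 2, X ≠ {x}) : (hubbardTTPrimeFermionInteraction 0 0 1).Φ X = 0 := by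
  by_cases h2 : ∃ (x : Site 2) (i : Fin 2), X = {x, x + unitVec i}
  · obtain ⟨x, i, rfl⟩ := h2
    rw [hubbardTTPrimeFermionInteraction_apply_pair_unitVec, hubbardFermionInteraction_apply_pair,
      Complex.ofReal_zero, neg_zero, zero_smul]
  by_cases h3 : ∃ (x : Site 2) (s : Fin 2), X = {x, x + diagVec s}
  · obtain ⟨x, s, rfl⟩ := h3
    rw [hubbardTTPrimeFermionInteraction_apply_pair_diagVec, diagHoppingFermionInteraction_apply_pair,
      Complex.ofReal_zero, neg_zero, zero_smul]
  push Not at h2 h3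
  exact hubbardTTPrimeFermionInteraction_apply_eq_zero 0 0 1 h1 h2 h3

namespace InfVolFermionState

/-- **The on-site conjugate density is the double occupancy, for EVERY state**:
`e_{Φ(0,0,1)}(ω) = Re ω(n_{0↑} n_{0↓})` (the tree had it for torus limits only,
`IsTorusLimitOf.meanEnergy_onSite_eq_re_expect_docc`). [cite: KomaTasaki1994, §1] -/
theorem meanEnergy_hubbardTTPrime_onSite_eq_re_expect_docc (ω : InfVolFermionState 2) :
    ω.meanEnergy (hubbardTTPrimeFermionInteraction 0 0 1) 1 =
      (ω.expect ({0} : Finset (Site 2))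
        (nAt 0 (mem_singleton_self 0) 0 * nAt 0 (mem_singleton_self 0) 1)).re := by
  rw [ω.meanEnergy_of_onSite _ (fun _ h => hubbardTTPrimeFermionInteraction_onSite_apply_eq_zero h),
    hubbardTTPrimeFermionInteraction_apply_singleton, Complex.ofReal_one, one_smul]

/-- **`0 ≤ D(ω)` for every state.** [cite: KomaTasaki1994, §1] -/
theorem meanEnergy_hubbardTTPrime_onSite_nonneg (ω : InfVolFermionState 2) :
    0 ≤ ω.meanEnergy (hubbardTTPrimeFermionInteraction 0 0 1) 1 := by
  rw [ω.meanEnergy_hubbardTTPrime_onSite_eq_re_expect_docc]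
  exact ω.re_expect_docc_nonneg

/-- **`D(ω) ≤ ρ(ω)/2` for every state** (`D ≤ ⟨n_↑⟩`, `D ≤ ⟨n_↓⟩`). [cite: Ruelle1969, §3.4] -/
theorem meanEnergy_hubbardTTPrime_onSite_le_half_density (ω : InfVolFermionState 2) :
    ω.meanEnergy (hubbardTTPrimeFermionInteraction 0 0 1) 1 ≤ ω.density / 2 := by
  rw [ω.meanEnergy_hubbardTTPrime_onSite_eq_re_expect_docc]
  have hu := ω.re_expect_nAt_mul_nAt_le
  have hd := ω.re_expect_nAt_mul_nAt_le_down
  have hρ : ω.density = (ω.expect {0} (nAt (0 : Site 2) (mem_singleton_self 0) 0)).re +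
      (ω.expect {0} (nAt (0 : Site 2) (mem_singleton_self 0) 1)).re := by
    rw [density, densityAt, map_add, Complex.add_re]
  rw [hρ]
  linarith

/-- **The double-occupancy bracket of the filling class**: `D(σ) ∈ [0, ρ/2]` for every state of
density `ρ`. [cite: Ruelle1969, §3.4] -/
theorem meanEnergy_hubbardTTPrime_onSite_mem_Icc (ω : InfVolFermionState 2) {ρ : ℝ} (hρ : ω.density = ρ) :
    ω.meanEnergy (hubbardTTPrimeFermionInteraction 0 0 1) 1 ∈ Set.Icc 0 (ρ / 2) :=
  ⟨ω.meanEnergy_hubbardTTPrime_onSite_nonneg, hρ ▸ ω.meanEnergy_hubbardTTPrime_onSite_le_half_density⟩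

/-- **`|K₁(σ)| ≤ 16/π²` for EVERY translation-invariant state of filling `0 < ρ < 2`** (variational
inequality at `(±1, 0, 0)` against the half-filled free band; no torus-limit hypothesis).
[cite: LiebLoss1993, §8, Theorem 8.2] -/
theorem IsTranslationInvariant.abs_meanEnergy_nnHop_le {ω : InfVolFermionState 2}
    (hω : ω.IsTranslationInvariant) (hρ0 : 0 < ω.density) (hρ2 : ω.density < 2) :
    |ω.meanEnergy (hubbardTTPrimeFermionInteraction 1 0 0) 1| ≤ 16 / Real.pi ^ 2 := by
  have hlo := neg_sixteen_mul_abs_div_pi_sq_le_energyDensityTT' 1 le_rfl hρ0.le hρ2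
  have hlo' := neg_sixteen_mul_abs_div_pi_sq_le_energyDensityTT' (-1) le_rfl hρ0.le hρ2
  rw [abs_one, mul_one, neg_div] at hlo
  rw [abs_neg, abs_one, mul_one, neg_div] at hlo'
  have h1 := hω.energyDensityTT'_le_meanEnergy 1 0 le_rfl hρ0 hρ2
  have h2 := hω.energyDensityTT'_le_meanEnergy (-1) 0 le_rfl hρ0 hρ2
  rw [ω.meanEnergy_hubbardTTPrime_eq_coords (-1) 0 0, zero_mul, zero_mul, add_zero, add_zero,
    neg_one_mul] at h2
  rw [abs_le]
  exact ⟨hlo.trans h1, by linarith⟩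

/-- **The kinematic brackets of the filling class, in the `linearFamily` indexing**
`hubbardTTPrimeDirections = (Φ(1,0,0), Φ(0,1,0), Φ(0,0,1))`: for every translation-invariant `σ` of
filling `ρ ∈ (0,2)` and every direction `a`,
`e_{Ψ_a}(σ) ∈ [lo_a, hi_a]` with `lo = (−16/π², −16/π², 0)`, `hi = (16/π², 16/π², ρ/2)`.
[cite: LiebLoss1993, §8, Theorem 8.2] -/
theorem IsTranslationInvariant.meanEnergy_hubbardTTPrimeDirections_mem_Icc {ω : InfVolFermionState 2}
    (hω : ω.IsTranslationInvariant) {ρ : ℝ} (hρ0 : 0 < ρ) (hρ2 : ρ < 2) (hρ : ω.density = ρ) (a : Fin 3) :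
    ω.meanEnergy (hubbardTTPrimeDirections a) 1 ∈
      Set.Icc ((![-(16 / Real.pi ^ 2), -(16 / Real.pi ^ 2), 0] : Fin 3 → ℝ) a)
        ((![16 / Real.pi ^ 2, 16 / Real.pi ^ 2, ρ / 2] : Fin 3 → ℝ) a) := by
  have hK₂ := abs_le.1 (hω.abs_meanEnergy_diagHop_le hρ hρ0 hρ2)
  subst hρ
  have hK₁ := abs_le.1 (hω.abs_meanEnergy_nnHop_le hρ0 hρ2)
  have hD := ω.meanEnergy_hubbardTTPrime_onSite_mem_Icc rfl
  fin_cases a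
  · simpa [hubbardTTPrimeDirections] using hK₁
  · simpa [hubbardTTPrimeDirections] using hK₂
  · simpa [hubbardTTPrimeDirections] using hD

end InfVolFermionState

/-! ### §2. The box rule for energy-window words -/

section BoxRule

/-- The `t–t'–U` interaction in `linearFamily` coordinates `θ = (t, t', U)`. [cite: XuEtAl2024, eq. (1)] -/
theorem hubbardTTPrimeFermionInteraction_eq_linearFamily_vec (t t' U : ℝ) :
    hubbardTTPrimeFermionInteraction t t' U =
      FermionInteraction.linearFamily (hubbardTTPrimeFermionInteraction 0 0 0) hubbardTTPrimeDirections
        ![t, t', U] := by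
  simpa using hubbardTTPrimeFermionInteraction_eq_linearFamily ![t, t', U]

/-- **THE BOX RULE, general brackets.** Let `0 < ρ < 2`, an anchor `(t₀, t'₀, U₀)` with `U₀ ≥ 0`, and
an ENERGY-WINDOW WORD at the anchor: every translation-invariant `σ` of filling `ρ` with
`e_{Φ(t₀,t'₀,U₀)}(σ) ≤ e(t₀,t'₀,U₀,ρ) + ε` satisfies `P σ`. Let `[lo_a, hi_a]` bracket the three
conjugate densities `(K₁, K₂, D)` of every translation-invariant state of filling `ρ` (certified or
kinematic). Then every translation-invariant `ω` of filling `ρ` that minimises `e_{Φ(t,t',U)}` over the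
filling class satisfies `P`, provided
`|t − t₀|(hi₀ − lo₀) + |t' − t'₀|(hi₁ − lo₁) + |U − U₀|(hi₂ − lo₂) ≤ ε`. [cite: WangEtAl2024, §III] -/
theorem hubbardTTPrime_energyWindow_word_of_isMinOn_of_brackets {ρ : ℝ} (hρ0 : 0 < ρ) (hρ2 : ρ < 2)
    {P : InfVolFermionState 2 → Prop} {t₀ t'₀ U₀ : ℝ} (hU₀ : 0 ≤ U₀) {ε : ℝ}
    (hword : ∀ σ : InfVolFermionState 2, σ.IsTranslationInvariant → σ.density = ρ →
      σ.meanEnergy (hubbardTTPrimeFermionInteraction t₀ t'₀ U₀) 1 ≤ energyDensityTT' t₀ t'₀ U₀ ρ + ε → P σ)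
    {lo hi : Fin 3 → ℝ}
    (hB : ∀ σ : InfVolFermionState 2, σ.IsTranslationInvariant → σ.density = ρ →
      ∀ a, σ.meanEnergy (hubbardTTPrimeDirections a) 1 ∈ Set.Icc (lo a) (hi a))
    {t t' U : ℝ}
    (hbudget : |t - t₀| * (hi 0 - lo 0) + |t' - t'₀| * (hi 1 - lo 1) + |U - U₀| * (hi 2 - lo 2) ≤ ε)
    {ω : InfVolFermionState 2} (hω : ω.IsTranslationInvariant) (hρ : ω.density = ρ)
    (hmin : ∀ σ : InfVolFermionState 2, σ.IsTranslationInvariant → σ.density = ρ →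
      ω.meanEnergy (hubbardTTPrimeFermionInteraction t t' U) 1 ≤
        σ.meanEnergy (hubbardTTPrimeFermionInteraction t t' U) 1) : P ω := by
  set S : Set (InfVolFermionState 2) := {σ | σ.IsTranslationInvariant ∧ σ.density = ρ} with hS
  have hinf : FermionInteraction.infMeanEnergyOn S
      (FermionInteraction.linearFamily (hubbardTTPrimeFermionInteraction 0 0 0) hubbardTTPrimeDirections
        ![t₀, t'₀, U₀]) 1 = energyDensityTT' t₀ t'₀ U₀ ρ := by
    rw [← hubbardTTPrimeFermionInteraction_eq_linearFamily_vec,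
      ← tiGroundEnergyDensityAt_hubbardTTPrime_eq_energyDensityTT' t₀ t'₀ hU₀ hρ0 hρ2]
    rfl
  refine InfVolFermionState.of_energyWindow_word_of_isMinOn (S := S)
    (hubbardTTPrimeFermionInteraction 0 0 0) hubbardTTPrimeDirections 1 (P := P) (θ₀ := ![t₀, t'₀, U₀])
    (ε := ε) (lo := lo) (hi := hi) (θ := ![t, t', U]) ?_ ?_ ?_ ⟨hω, hρ⟩ ?_
  · intro σ hσ hle
    rw [hinf, ← hubbardTTPrimeFermionInteraction_eq_linearFamily_vec] at hle
    exact hword σ hσ.1 hσ.2 hle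
  · exact fun σ hσ a => hB σ hσ.1 hσ.2 a
  · rw [Fin.sum_univ_three]
    simpa using hbudget
  · rw [isMinOn_iff]
    intro σ hσ
    rw [← hubbardTTPrimeFermionInteraction_eq_linearFamily_vec]
    exact hmin σ hσ.1 hσ.2

/-- **THE BOX RULE with the kinematic budget.** Same, with the class-wide kinematic brackets of §1:
the anchor word holds for every filling-class minimiser `ω` at `(t, t', U)` as soon as
`(|t − t₀| + |t' − t'₀|)·(32/π²) + |U − U₀|·(ρ/2) ≤ ε`. [cite: WangEtAl2024, §III] -/
theorem hubbardTTPrime_energyWindow_word_of_isMinOn {ρ : ℝ} (hρ0 : 0 < ρ) (hρ2 : ρ < 2)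
    {P : InfVolFermionState 2 → Prop} {t₀ t'₀ U₀ : ℝ} (hU₀ : 0 ≤ U₀) {ε : ℝ}
    (hword : ∀ σ : InfVolFermionState 2, σ.IsTranslationInvariant → σ.density = ρ →
      σ.meanEnergy (hubbardTTPrimeFermionInteraction t₀ t'₀ U₀) 1 ≤ energyDensityTT' t₀ t'₀ U₀ ρ + ε → P σ)
    {t t' U : ℝ}
    (hbudget : (|t - t₀| + |t' - t'₀|) * (32 / Real.pi ^ 2) + |U - U₀| * (ρ / 2) ≤ ε)
    {ω : InfVolFermionState 2} (hω : ω.IsTranslationInvariant) (hρ : ω.density = ρ)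
    (hmin : ∀ σ : InfVolFermionState 2, σ.IsTranslationInvariant → σ.density = ρ →
      ω.meanEnergy (hubbardTTPrimeFermionInteraction t t' U) 1 ≤
        σ.meanEnergy (hubbardTTPrimeFermionInteraction t t' U) 1) : P ω := by
  refine hubbardTTPrime_energyWindow_word_of_isMinOn_of_brackets hρ0 hρ2 hU₀ hword
    (lo := ![-(16 / Real.pi ^ 2), -(16 / Real.pi ^ 2), 0])
    (hi := ![16 / Real.pi ^ 2, 16 / Real.pi ^ 2, ρ / 2])
    (fun σ hσ hσρ a => hσ.meanEnergy_hubbardTTPrimeDirections_mem_Icc hρ0 hρ2 hσρ a) ?_ hω hρ hmin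
  simp only [Matrix.cons_val_zero, Matrix.cons_val_one, Matrix.cons_val_two, Matrix.tail_cons,
    Matrix.head_cons]
  ring_nf at hbudget ⊢
  linarith

end BoxRule

/-! ### §3. Torus-limit ground states are filling-class minimisers; the box rule on them -/

namespace InfVolFermionState

/-- **Torus-limit ground states minimise the mean energy over the filling class**: for `U ≥ 0`,
`0 < n < 2`, a torus limit `ω` of unit sector ground states (`rectN n`, `S^z = 0`) along `Ls → ∞` has
`e^{tt'}(ω) ≤ e^{tt'}(σ)` for every translation-invariant `σ` of density `n` (`e^{tt'}(ω) = e(t,t',U,n)`,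
the variational principle). [cite: Ruelle1969, §3.4] -/
theorem IsTorusLimitOf.meanEnergy_le_of_filling (t t' : ℝ) {U : ℝ} (hU : 0 ≤ U) {n : ℝ} (hn0 : 0 < n)
    (hn2 : n < 2) {ω : InfVolFermionState 2} {ψ : ∀ L, Fock (Orb (FermionTorus 2 L))} {Ls : ℕ → ℕ}
    (h : ω.IsTorusLimitOf ψ Ls) (hLs : Tendsto Ls atTop atTop)
    (hψ : ∀ j, IsGroundStateInSector (hubbardTorusTT' (Ls j) t t' U) (rectN n (Ls j)) 0 (ψ (Ls j)))
    (h1 : ∀ j, star (ψ (Ls j)) ⬝ᵥ ψ (Ls j) = 1)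
    {σ : InfVolFermionState 2} (hσ : σ.IsTranslationInvariant) (hσn : σ.density = n) :
    ω.meanEnergy (hubbardTTPrimeFermionInteraction t t' U) 1 ≤
      σ.meanEnergy (hubbardTTPrimeFermionInteraction t t' U) 1 := by
  rw [h.meanEnergy_hubbardTTPrime_eq_energyDensityTT' t t' hU hn0.le hn2 hLs hψ h1]
  exact energyDensityTT'_le_meanEnergy_of_isTranslationInvariant t t' hU hn0 hn2 hσ hσn

/-- **THE BOX RULE ON TORUS-LIMIT GROUND STATES (kinematic budget).** An energy-window word issued at
the anchor `(t₀, t'₀, U₀)` (`U₀ ≥ 0`) for all translation-invariant states of filling `n ∈ (0,2)`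
within `ε` of `e(t₀,t'₀,U₀,n)` holds for EVERY torus-limit ground state at EVERY `(t, t', U)` with
`U ≥ 0` and `(|t − t₀| + |t' − t'₀|)·(32/π²) + |U − U₀|·(n/2) ≤ ε` — the form in which a pairing /
correlator word certified at one point of a material box covers the box. [cite: WangEtAl2024, §III] -/
theorem IsTorusLimitOf.of_energyWindow_word_on_box {n : ℝ} (hn0 : 0 < n) (hn2 : n < 2)
    {P : InfVolFermionState 2 → Prop} {t₀ t'₀ U₀ : ℝ} (hU₀ : 0 ≤ U₀) {ε : ℝ}
    (hword : ∀ σ : InfVolFermionState 2, σ.IsTranslationInvariant → σ.density = n →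
      σ.meanEnergy (hubbardTTPrimeFermionInteraction t₀ t'₀ U₀) 1 ≤ energyDensityTT' t₀ t'₀ U₀ n + ε → P σ)
    (t t' : ℝ) {U : ℝ} (hU : 0 ≤ U)
    (hbudget : (|t - t₀| + |t' - t'₀|) * (32 / Real.pi ^ 2) + |U - U₀| * (n / 2) ≤ ε)
    {ω : InfVolFermionState 2} {ψ : ∀ L, Fock (Orb (FermionTorus 2 L))} {Ls : ℕ → ℕ}
    (h : ω.IsTorusLimitOf ψ Ls) (hLs : Tendsto Ls atTop atTop)
    (hψ : ∀ j, IsGroundStateInSector (hubbardTorusTT' (Ls j) t t' U) (rectN n (Ls j)) 0 (ψ (Ls j)))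
    (hN : ∀ j, IsNParticle (rectN n (Ls j)) (ψ (Ls j)))
    (h1 : ∀ j, star (ψ (Ls j)) ⬝ᵥ ψ (Ls j) = 1) : P ω :=
  hubbardTTPrime_energyWindow_word_of_isMinOn hn0 hn2 hU₀ hword hbudget h.isTranslationInvariant
    (h.density_eq_of_rectN hLs hn0.le hN h1)
    (fun _ hσ hσn => h.meanEnergy_le_of_filling t t' hU hn0 hn2 hLs hψ h1 hσ hσn)

/-- **The box rule on torus-limit ground states, certified brackets.** Same with class-wide brackets
`[lo_a, hi_a]` on `(K₁, K₂, D)` (e.g. certified words valid for all translation-invariant states of the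
filling) and the budget `|t − t₀|(hi₀ − lo₀) + |t' − t'₀|(hi₁ − lo₁) + |U − U₀|(hi₂ − lo₂) ≤ ε`.
[cite: WangEtAl2024, §III] -/
theorem IsTorusLimitOf.of_energyWindow_word_on_box_of_brackets {n : ℝ} (hn0 : 0 < n) (hn2 : n < 2)
    {P : InfVolFermionState 2 → Prop} {t₀ t'₀ U₀ : ℝ} (hU₀ : 0 ≤ U₀) {ε : ℝ}
    (hword : ∀ σ : InfVolFermionState 2, σ.IsTranslationInvariant → σ.density = n →
      σ.meanEnergy (hubbardTTPrimeFermionInteraction t₀ t'₀ U₀) 1 ≤ energyDensityTT' t₀ t'₀ U₀ n + ε → P σ)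
    {lo hi : Fin 3 → ℝ}
    (hB : ∀ σ : InfVolFermionState 2, σ.IsTranslationInvariant → σ.density = n →
      ∀ a, σ.meanEnergy (hubbardTTPrimeDirections a) 1 ∈ Set.Icc (lo a) (hi a))
    (t t' : ℝ) {U : ℝ} (hU : 0 ≤ U)
    (hbudget : |t - t₀| * (hi 0 - lo 0) + |t' - t'₀| * (hi 1 - lo 1) + |U - U₀| * (hi 2 - lo 2) ≤ ε)
    {ω : InfVolFermionState 2} {ψ : ∀ L, Fock (Orb (FermionTorus 2 L))} {Ls : ℕ → ℕ}
    (h : ω.IsTorusLimitOf ψ Ls) (hLs : Tendsto Ls atTop atTop)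
    (hψ : ∀ j, IsGroundStateInSector (hubbardTorusTT' (Ls j) t t' U) (rectN n (Ls j)) 0 (ψ (Ls j)))
    (hN : ∀ j, IsNParticle (rectN n (Ls j)) (ψ (Ls j)))
    (h1 : ∀ j, star (ψ (Ls j)) ⬝ᵥ ψ (Ls j) = 1) : P ω :=
  hubbardTTPrime_energyWindow_word_of_isMinOn_of_brackets hn0 hn2 hU₀ hword hB hbudget
    h.isTranslationInvariant (h.density_eq_of_rectN hLs hn0.le hN h1)
    (fun _ hσ hσn => h.meanEnergy_le_of_filling t t' hU hn0 hn2 hLs hψ h1 hσ hσn)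

end InfVolFermionState

end Literature.MathematicalPhysics.QuantumLattice

end
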